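import Literature.Analysis.FluidPDE.ChaeGeneralizedSelfSimilar
import Literature.Analysis.FluidPDE.SwirlMaximumPrinciple
import Literature.Analysis.FluidPDE.VorticityEquation
import Literature.Analysis.FluidPDE.NSVorticityBKM
import Literature.Analysis.FluidPDE.NSVorticityBKMHolds
import Literature.Analysis.FluidPDE.NSVorticityBKMTools
import Mathlib.Analysis.SpecialFunctions.Integrability.Basic
import Mathlib.Analysis.InnerProductSpace.Laplacian
import Mathlib.Analysis.Calculus.FDeriv.CompCLM
import HarnessLib

/-!
# The Type-I STRETCHING threshold `limsup (T−t)·sup α⁺(t) ≥ 1` at a blow-up time, `ν ≥ 0`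
# (`α = ⟪ξ, ∇u ξ⟫`, `ξ = ω/|ω|`, the vortex-stretching rate) — Chae's threshold in its sharp form

Analysis/FluidPDE proof file (no definitions, no named facts, no `sorry`). The tree's
`TypeIGradientThreshold.lean` proves, for classical unforced Navier–Stokes / Euler solutions (`ν ≥ 0`) of the
Beale–Kato–Majda class on `ℝ³ × [0, T)`, that `(T − t)‖∇u(t)‖_∞ ≤ M₀ < 1` on a terminal window forces
continuation past `T` (D. Chae, J. Funct. Anal. 258 (2010) 2865–2883 = arXiv:0711.1113, Thm 1.1, stated there for
Euler). Its maximum-principle proof uses the gradient bound at ONE place only: the stretching term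
`⟪ω, ∇u ω⟫ ≤ ‖∇u‖ |ω|²`. This file records the same theorem with the hypothesis weakened to what is used — a bound
on the VORTEX-STRETCHING RATE `α(t, x) = ⟪ξ, ∇u(t, x) ξ⟫ = ⟪ξ, S ξ⟫`, `ξ = ω/|ω|` (Constantin 1994; the
`|ω|`-equation `∂ₜ|ω| + u·∇|ω| − νΔ|ω| ≤ α|ω|`), in the division-free form `⟪ω, ∇u ω⟫ ≤ λ(t) |ω|²`:

* `exp_neg_mul_norm_curl_le_of_stretching_le_of_nonneg` — **sup-norm growth of the vorticity under a STRETCHING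
  bound, `ν ≥ 0`**: for a classical solution on `ℝ³ × [0, T)` with bounded velocity and vorticity on `[t₀, t₁] × ℝ³`
  and `⟪ω(s, x), ∇u(s, x) ω(s, x)⟫ ≤ Λ′(s) |ω(s, x)|²` on `(t₀, t₁]`, `Λ(t₀) = 0`: `e^{−Λ(t)}|ω(t, x)| ≤ sup|ω(t₀, ·)|`
  (the tree's proof verbatim — weak parabolic maximum principle for `e^{−2Λ}|ω|² − (M² + εe^{β(t−t₀)}(1+|x|²))`
  — with the stretching step read off the hypothesis);
* `norm_curl_le_mul_rpow_of_typeI_stretching_of_nonneg` — with `Λ = M₀ log((T−t₀)/(T−t))`: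
  `(T−t)⟪ω, ∇u ω⟫ ≤ M₀|ω|²` on `[t₀, T) × ℝ³` gives `‖ω(t, x)‖ ≤ ‖ω(t₀)‖_∞((T−t₀)/(T−t))^{M₀}`;
* `typeI_stretching_threshold_of_nonneg` — **the threshold theorem for every `ν ≥ 0`**: a classical unforced
  solution of the Beale–Kato–Majda class with `(T−t)⟪ω, ∇u ω⟫(t, x) ≤ M₀ |ω(t, x)|²` on `[t₀, T) × ℝ³` for some
  `M₀ < 1` continues in the class past `T` (`M₀ < 1` makes `(T−t)^{−M₀}` integrable, so `∫₀ᵀ‖ω‖_∞ < ∞`, and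
  Beale–Kato–Majda for `ν ≥ 0`, `beale_kato_majda_holds`);
* `exists_typeI_stretching_gt_of_not_hasSobolevExtensionPast` — blow-up form: if `T` IS a blow-up time of the class
  then for every `M₀ < 1` and `t₀ < T` there are `t ∈ [t₀, T)`, `x` with `M₀|ω(t, x)|² < (T−t)⟪ω, ∇u ω⟫(t, x)` — i.e.
  `ω(t, x) ≠ 0` and `(T − t)·α(t, x) > M₀`: `limsup_{t→T} (T−t) sup_x α⁺(t, x) ≥ 1`. Since
  `α ≤ λ_max(S) ≤ ‖S‖ ≤ ‖∇u‖`, this sharpens the gradient form (`exists_typeI_gradient_gt_of_not_hasSobolevExtensionPast`)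
  and bounds the largest strain eigenvalue along the vorticity direction with the explicit constant `1`.

WHAT THIS IS NOT: not a regularity or blow-up claim — a kernel continuation criterion for classical solutions of the
Beale–Kato–Majda class, `ν ≥ 0`. HONEST PLACEMENT: Chae 2010 Thm 1.1 is printed with `‖∇v‖_∞` and for Euler; the
stretching-rate form is the same proof (the `|ω|`-transport inequality with `α` is Constantin 1994 / Constantin–Fefferman
1993); no printed statement of the `α`-threshold with constant `1` was located. Written by the `pub-fluidc` theorem lane
(p2 gen 20) as the kernel of its dictionary row L66.

## References

* D. Chae, J. Funct. Anal. 258 (2010) 2865–2883 = arXiv:0711.1113: Thm 1.1 and its proof (arXiv p. 3–4). [`Chae2010`]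
* P. Constantin, SIAM Rev. 36 (1994) 73–98 (the stretching rate `α = ⟪ξ, Sξ⟩`). [`Constantin1994`]
* J. T. Beale, T. Kato, A. Majda, Comm. Math. Phys. 94 (1984) 61–66, Thm 1. [`BealeKatoMajda1984`]
* A. J. Majda, A. L. Bertozzi, *Vorticity and Incompressible Flow*, CUP 2002, Thm 3.6, remark p. 117, §4.2 (4.48).
  [`MajdaBertozziCUP2002`]
* G. M. Lieberman, *Second order parabolic differential equations*, World Scientific 1996, Ch. II (tree
  `weak_max_principle`). [`Lieberman1996`]
-/

noncomputable section

open MeasureTheory Set Function Filter Topology Metric InnerProductSpace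
open scoped RealInnerProductSpace NNReal ENNReal ContDiff Laplacian

namespace Literature.Analysis.FluidPDE

section LaplacianNormSq

variable {E : Type*} [NormedAddCommGroup E] [InnerProductSpace ℝ E] [FiniteDimensional ℝ E]
variable {F : Type*} [NormedAddCommGroup F] [InnerProductSpace ℝ F]

/-! ### `Δ|f|² = 2⟪f, Δf⟫ + 2|∇f|²` -/

/-- Directional second derivatives compute the Laplacian of a `C²` map:
`Δ f x = ∑ i, ∂ᵢ(∂ᵢ f)(x)` in any orthonormal basis (Mathlib's
`laplacian_eq_iteratedFDeriv_orthonormalBasis` unfolded; restated privately — the tree has the same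
formula in several support files under local names). [folklore] -/
private theorem laplacian_eq_sum_fderiv_fderiv_dir {ι : Type*} [Fintype ι] (b : OrthonormalBasis ι ℝ E)
    {f : E → F} (hf : ContDiff ℝ 2 f) (x : E) :
    (Δ f) x = ∑ i, fderiv ℝ (fun y => fderiv ℝ f y (b i)) x (b i) := by
  have hD : DifferentiableAt ℝ (fderiv ℝ f) x :=
    (hf.fderiv_right (m := 1) (by norm_num)).differentiable (by simp) x
  rw [congrFun (laplacian_eq_iteratedFDeriv_orthonormalBasis f b) x]
  refine Finset.sum_congr rfl fun i _ => ?_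
  rw [iteratedFDeriv_two_apply, fderiv_clm_apply hD (differentiableAt_const _)]
  simp

/-- **`Δ|f|² = 2⟪f, Δf⟫ + 2|∇f|²`** for a `C²` map `f : E → F` between real inner product spaces
(`E` finite-dimensional), in an orthonormal basis `b` of `E`:
`Δ(‖f‖²)(x) = 2⟪f(x), Δf(x)⟫ + 2 ∑ᵢ ‖∂ᵢ f(x)‖²` (product rule; private helper). [folklore] -/
private theorem laplacian_norm_sq_eq {ι : Type*} [Fintype ι] (b : OrthonormalBasis ι ℝ E)
    {f : E → F} (hf : ContDiff ℝ 2 f) (x : E) :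
    (Δ (fun y => ‖f y‖ ^ 2)) x = 2 * ⟪f x, (Δ f) x⟫ + 2 * ∑ i, ‖fderiv ℝ f x (b i)‖ ^ 2 := by
  -- differentiability bookkeeping
  have hfd : Differentiable ℝ f := hf.differentiable (by simp)
  have hDf : ∀ v : E, Differentiable ℝ (fun y => fderiv ℝ f y v) := fun v =>
    ((hf.fderiv_right (m := 1) (by norm_num)).differentiable (by simp)).clm_apply
      (differentiable_const v)
  -- `‖f‖² = ⟪f, f⟫`
  have hg_eq : (fun y => ‖f y‖ ^ 2) = fun y => ⟪f y, f y⟫ := by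
    funext y; rw [real_inner_self_eq_norm_sq]
  have hg : ContDiff ℝ 2 (fun y => ⟪f y, f y⟫) := hf.inner ℝ hf
  -- first derivatives: `D(⟪f,f⟫)(y) v = ⟪f y, Df y v⟫ + ⟪Df y v, f y⟫`
  have hg1 : ∀ v : E, (fun y => fderiv ℝ (fun y => ⟪f y, f y⟫) y v) =
      fun y => ⟪f y, fderiv ℝ f y v⟫ + ⟪fderiv ℝ f y v, f y⟫ := fun v => by
    funext y
    exact fderiv_inner_apply ℝ (hfd y) (hfd y) v
  -- second derivatives along `b i`
  have hg2 : ∀ v : E, fderiv ℝ (fun y => fderiv ℝ (fun y => ⟪f y, f y⟫) y v) x v =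
      (⟪f x, fderiv ℝ (fun y => fderiv ℝ f y v) x v⟫ + ⟪fderiv ℝ f x v, fderiv ℝ f x v⟫) +
      (⟪fderiv ℝ f x v, fderiv ℝ f x v⟫ + ⟪fderiv ℝ (fun y => fderiv ℝ f y v) x v, f x⟫) := fun v => by
    rw [hg1 v]
    rw [fderiv_fun_add ((hfd x).inner ℝ (hDf v x)) ((hDf v x).inner ℝ (hfd x))]
    rw [add_apply, fderiv_inner_apply ℝ (hfd x) (hDf v x),
      fderiv_inner_apply ℝ (hDf v x) (hfd x)]
  rw [hg_eq, laplacian_eq_sum_fderiv_fderiv_dir b hg x, laplacian_eq_sum_fderiv_fderiv_dir b hf x]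
  simp_rw [hg2, inner_sum]
  rw [Finset.mul_sum, Finset.mul_sum, ← Finset.sum_add_distrib]
  refine Finset.sum_congr rfl fun i _ => ?_
  rw [real_inner_comm (f x) (fderiv ℝ (fun y => fderiv ℝ f y (b i)) x (b i)),
    real_inner_self_eq_norm_sq]
  ring

/-- Consequence: `2⟪f(x), Δf(x)⟫ ≤ Δ(‖f‖²)(x)` (private helper). [folklore] -/
private theorem two_mul_inner_laplacian_le_laplacian_norm_sq {f : E → F} (hf : ContDiff ℝ 2 f) (x : E) :
    2 * ⟪f x, (Δ f) x⟫ ≤ (Δ (fun y => ‖f y‖ ^ 2)) x := by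
  rw [laplacian_norm_sq_eq (stdOrthonormalBasis ℝ E) hf x]
  have : 0 ≤ ∑ i, ‖fderiv ℝ f x ((stdOrthonormalBasis ℝ E) i)‖ ^ 2 :=
    Finset.sum_nonneg fun i _ => by positivity
  linarith

end LaplacianNormSq

/-! ### Sup-norm growth of the vorticity under a stretching bound, `ν ≥ 0` -/

set_option maxHeartbeats 800000 in
/-- **Sup-norm growth of the vorticity of a classical Navier–Stokes / Euler solution (`ν ≥ 0`) under a bound on the
VORTEX-STRETCHING term** (the step "`‖ω(t)‖_∞ ≤ ‖ω(t₀)‖_∞ exp[∫_{t₀}^t ‖∇v(τ)‖_∞ dτ]`" of Chae 2010, proof of Thm 1.1,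
arXiv:0711.1113 p. 3, with `‖∇v‖_∞` replaced by a majorant of the stretching rate — the only property of `∇v` the
proof uses). Let `(u, p)` be a classical solution of the unforced system with viscosity `ν ≥ 0` on `ℝ³ × [0, T)`, let
`0 ≤ t₀ ≤ t₁ < T`, and assume on the slab `[t₀, t₁] × ℝ³` the bounds `|u| ≤ V`, `|ω| ≤ W` (`ω = curl u`), and
`|ω(t₀, ·)| ≤ M`. Let `Λ` be continuous and nonnegative on `[t₀, t₁]` with `Λ(t₀) = 0` and derivative `Λ′(s) = λ(s)`
on `(t₀, t₁]` such that `⟪ω(s, x), D(u s)(x) ω(s, x)⟫ ≤ λ(s) |ω(s, x)|²` for `s ∈ (t₀, t₁]` and all `x`. Then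
`e^{−Λ(t)} |ω(t, x)| ≤ M` on `[t₀, t₁] × ℝ³`. Proof: the tree's weak maximum principle argument for
`e^{−2Λ}|ω|² − (M² + εe^{β(t−t₀)}(1+|x|²))`, `β = 6ν + V + 1`, on the balls `|x| ≤ R`, `R ≥ W²/ε`, verbatim
(`exp_neg_mul_norm_curl_le_of_classical_of_nonneg`), the stretching step being the hypothesis.
[cite: Chae2010, Thm 1.1 (proof, arXiv:0711.1113 p. 3); Constantin1994, §2 (α); Lieberman1996, Ch. II Lemma 2.1] -/
theorem exp_neg_mul_norm_curl_le_of_stretching_le_of_nonneg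
    {ν T t₀ t₁ V W M : ℝ} {u : ℝ → (EuclideanSpace ℝ (Fin 3)) → (EuclideanSpace ℝ (Fin 3))} {p : ℝ → (EuclideanSpace ℝ (Fin 3)) → ℝ} {Λ lam : ℝ → ℝ}
    (hν : 0 ≤ ν) (hcl : IsClassicalNSSolutionOn (Ico 0 T) ν 0 u p)
    (ht₀ : 0 ≤ t₀) (h01 : t₀ ≤ t₁) (ht₁ : t₁ < T)
    (hV : ∀ t ∈ Icc t₀ t₁, ∀ x, ‖u t x‖ ≤ V)
    (hW : ∀ t ∈ Icc t₀ t₁, ∀ x, ‖curl (u t) x‖ ≤ W)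
    (hM : ∀ x, ‖curl (u t₀) x‖ ≤ M)
    (hΛc : ContinuousOn Λ (Icc t₀ t₁)) (hΛ0 : Λ t₀ = 0) (hΛnn : ∀ t ∈ Icc t₀ t₁, 0 ≤ Λ t)
    (hΛd : ∀ t ∈ Ioc t₀ t₁, HasDerivAt Λ (lam t) t)
    (hα : ∀ t ∈ Ioc t₀ t₁, ∀ x, ⟪curl (u t) x, fderiv ℝ (u t) x (curl (u t) x)⟫ ≤ lam t * ‖curl (u t) x‖ ^ 2) :
    ∀ t ∈ Icc t₀ t₁, ∀ x, Real.exp (-Λ t) * ‖curl (u t) x‖ ≤ M := by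
  have hM0 : 0 ≤ M := (norm_nonneg _).trans (hM 0)
  have hV0 : 0 ≤ V := (norm_nonneg _).trans (hV t₀ ⟨le_rfl, h01⟩ 0)
  have hW0 : 0 ≤ W := (norm_nonneg _).trans (hW t₀ ⟨le_rfl, h01⟩ 0)
  -- the sub-slab lies inside `[0, T)`
  have hsubI : Icc t₀ t₁ ⊆ Ico 0 T := fun s hs => ⟨ht₀.trans hs.1, hs.2.trans_lt ht₁⟩
  -- the vorticity: joint smoothness, the vorticity equation
  set om : ℝ → (EuclideanSpace ℝ (Fin 3)) → (EuclideanSpace ℝ (Fin 3)) := vorticity u with hom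
  have hom_app : ∀ t x, om t x = curl (u t) x := fun t x => by rw [hom, vorticity_apply]
  have hsm := hcl.smooth_velocity
  have homsm : IsSmoothSpaceTimeOn (Ico 0 T) om := hsm.isSmoothSpaceTimeOn_vorticity (uniqueDiffOn_Ico 0 T)
  have hvort : IsVorticitySolutionOn (Ico 0 T) ν u := hcl.isVorticitySolutionOn_Ico fun _ _ y => curl_zero y
  set omt : ℝ → (EuclideanSpace ℝ (Fin 3)) → (EuclideanSpace ℝ (Fin 3)) := fun t x => timeDerivWithin (Ico 0 T) om t x with homt
  -- constants of the barrier
  set β : ℝ := 6 * ν + V + 1 with hβ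
  have hβ0 : 0 ≤ β := by rw [hβ]; positivity
  -- the claim for every `ε > 0`, on every large ball
  suffices key : ∀ ε : ℝ, 0 < ε → ∀ R : ℝ, W ^ 2 / ε ≤ R →
      ∀ t ∈ Icc t₀ t₁, ∀ x ∈ closedBall (0 : (EuclideanSpace ℝ (Fin 3))) R,
        Real.exp (-2 * Λ t) * ‖om t x‖ ^ 2 - (M ^ 2 + ε * Real.exp (β * (t - t₀)) * (1 + ‖x‖ ^ 2)) ≤ 0 by
    intro t ht x
    have hsq : Real.exp (-2 * Λ t) * ‖om t x‖ ^ 2 ≤ M ^ 2 := by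
      refine le_of_forall_pos_le_add fun η hη => ?_
      set C : ℝ := Real.exp (β * (t - t₀)) * (1 + ‖x‖ ^ 2) with hC
      have hCpos : 0 < C := by positivity
      have h := key (η / C) (div_pos hη hCpos) (max (W ^ 2 / (η / C)) ‖x‖) (le_max_left _ _) t ht x
        (mem_closedBall_zero_iff.2 (le_max_right _ _))
      have e : η / C * Real.exp (β * (t - t₀)) * (1 + ‖x‖ ^ 2) = η := by
        rw [hC]; field_simp
      rw [e] at h
      linarith
    have hexp : Real.exp (-2 * Λ t) = Real.exp (-Λ t) ^ 2 := by
      rw [← Real.exp_nat_mul]; congr 1; push_cast; ring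
    rw [hexp, ← mul_pow, hom_app] at hsq
    exact (pow_le_pow_iff_left₀ (by positivity) hM0 two_ne_zero).1 hsq
  intro ε hε R hR
  have hR0 : 0 ≤ R := le_trans (by positivity) hR
  -- the comparison function and its time derivative
  set w : ℝ → (EuclideanSpace ℝ (Fin 3)) → ℝ := fun t x =>
    Real.exp (-2 * Λ t) * ‖om t x‖ ^ 2 - (M ^ 2 + ε * Real.exp (β * (t - t₀)) * (1 + ‖x‖ ^ 2)) with hw
  set wₜ : ℝ → (EuclideanSpace ℝ (Fin 3)) → ℝ := fun t x =>
    Real.exp (-2 * Λ t) * (-2 * lam t) * ‖om t x‖ ^ 2 +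
      Real.exp (-2 * Λ t) * (2 * ⟪om t x, omt t x⟫) -
      ε * (Real.exp (β * (t - t₀)) * β) * (1 + ‖x‖ ^ 2) with hwₜ
  set K : Set (EuclideanSpace ℝ (Fin 3)) := closedBall 0 R with hK
  set U : Set (EuclideanSpace ℝ (Fin 3)) := ball 0 R with hU
  have hKc : IsCompact K := isCompact_closedBall _ _
  have hUo : IsOpen U := isOpen_ball
  have hUK : U ⊆ K := ball_subset_closedBall
  -- regularity of the vorticity slices
  have homC : ∀ t ∈ Ico 0 T, ContDiff ℝ 2 (om t) := fun t ht =>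
    (homsm.contDiff_slice ht).of_le (by norm_cast)
  have homd : ∀ t ∈ Ico 0 T, ∀ x, DifferentiableAt ℝ (om t) x := fun t ht x =>
    ((homC t ht).of_le one_le_two).differentiable one_ne_zero x
  -- (a) joint continuity
  have hc : ContinuousOn (uncurry w) (Icc t₀ t₁ ×ˢ K) := by
    have homc : ContinuousOn (uncurry om) (Icc t₀ t₁ ×ˢ K) :=
      homsm.continuousOn.mono (prod_mono hsubI (subset_univ _))
    have hΛc' : ContinuousOn (fun q : ℝ × (EuclideanSpace ℝ (Fin 3)) => Λ q.1) (Icc t₀ t₁ ×ˢ K) :=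
      hΛc.comp continuous_fst.continuousOn fun q hq => hq.1
    have h1 : ContinuousOn (fun q : ℝ × (EuclideanSpace ℝ (Fin 3)) => Real.exp (-2 * Λ q.1) * ‖uncurry om q‖ ^ 2)
        (Icc t₀ t₁ ×ˢ K) :=
      ((continuousOn_const.mul hΛc').rexp).mul (homc.norm.pow 2)
    have h2 : Continuous fun q : ℝ × (EuclideanSpace ℝ (Fin 3)) =>
        M ^ 2 + ε * Real.exp (β * (q.1 - t₀)) * (1 + ‖q.2‖ ^ 2) := by
      fun_prop
    exact (h1.sub h2.continuousOn).congr fun q _ => by simp only [hw, uncurry, Pi.sub_apply]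
  -- (b) smooth slices
  have h2 : ∀ t ∈ Ioc t₀ t₁, ContDiff ℝ 2 (w t) := fun t ht =>
    (contDiff_const.mul ((homC t (hsubI ⟨ht.1.le, ht.2⟩)).norm_sq ℝ)).sub
      (contDiff_barrier (M ^ 2) (ε * Real.exp (β * (t - t₀))))
  -- (c) the left time derivative
  have ht : ∀ t ∈ Ioc t₀ t₁, ∀ x ∈ U, HasDerivWithinAt (fun s => w s x) (wₜ t x) (Icc t₀ t) t := by
    intro t ht x _
    have htS : t ∈ Ico 0 T := hsubI ⟨ht.1.le, ht.2⟩
    have homdt : HasDerivWithinAt (fun s => om s x) (omt t x) (Ico 0 T) t :=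
      homsm.hasDerivWithinAt_timeDerivWithin (uniqueDiffOn_Ico 0 T) htS x
    have hnsq : HasDerivWithinAt (fun s => ‖om s x‖ ^ 2) (2 * ⟪om t x, omt t x⟫) (Ico 0 T) t :=
      homdt.norm_sq
    have hexpΛ : HasDerivAt (fun s => Real.exp (-2 * Λ s)) (Real.exp (-2 * Λ t) * (-2 * lam t)) t :=
      ((hΛd t ht).const_mul (-2)).exp
    have hprod := hexpΛ.hasDerivWithinAt.mul hnsq
    have hbar : HasDerivWithinAt (fun s => M ^ 2 + ε * Real.exp (β * (s - t₀)) * (1 + ‖x‖ ^ 2))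
        (ε * (Real.exp (β * (t - t₀)) * β) * (1 + ‖x‖ ^ 2)) (Ico 0 T) t := by
      have h1 : HasDerivAt (fun s => Real.exp (β * (s - t₀))) (Real.exp (β * (t - t₀)) * β) t := by
        have := (((hasDerivAt_id t).sub_const t₀).const_mul β).exp
        simpa using this
      exact (((h1.const_mul ε).mul_const (1 + ‖x‖ ^ 2)).const_add (M ^ 2)).hasDerivWithinAt
    have h := (hprod.sub hbar).mono (show Icc t₀ t ⊆ Ico 0 T from
      fun s hs => ⟨ht₀.trans hs.1, (hs.2.trans ht.2).trans_lt ht₁⟩)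
    simp only [hw, hwₜ]
    exact h.congr_deriv (by ring)
  -- (d) the sub-solution implication, from the vorticity equation
  have hsub : ∀ t ∈ Ioc t₀ t₁, ∀ x ∈ U, fderiv ℝ (w t) x = 0 → (Δ (w t)) x ≤ 0 → wₜ t x ≤ 0 := by
    intro t ht x _ hgrad hlap
    have htI : t ∈ Icc t₀ t₁ := ⟨ht.1.le, ht.2⟩
    have htS : t ∈ Ico 0 T := hsubI htI
    set c : ℝ := ε * Real.exp (β * (t - t₀)) with hc
    have hc0 : 0 < c := by positivity
    set e : ℝ := Real.exp (-2 * Λ t) with he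
    have he0 : 0 < e := Real.exp_pos _
    -- the vorticity equation at `(t, x)`: `ωₜ + Dω(u) = Du(ω)`
    have hpde : omt t x =
        fderiv ℝ (u t) x (om t x) + ν • (Δ (om t)) x - fderiv ℝ (om t) x (u t x) := by
      have h := hvort.vorticity_eq t htS x
      rw [convect_apply, convect_apply] at h
      simpa [homt, hom] using eq_sub_of_add_eq h
    -- Laplacians at the critical point: `e Δ|ω|² ≤ 6c`, hence `e · 2⟪ω, Δω⟫ ≤ 6c`
    have hΔeq : (Δ (w t)) x = e * (Δ (fun y => ‖om t y‖ ^ 2)) x - 6 * c := by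
      have hn : ContDiff ℝ 2 (fun y => ‖om t y‖ ^ 2) := (homC t htS).norm_sq ℝ
      have h1 : ContDiffAt ℝ 2 (fun y => e * ‖om t y‖ ^ 2) x := (contDiff_const.mul hn).contDiffAt
      have h2 : ContDiffAt ℝ 2
          (fun y : (EuclideanSpace ℝ (Fin 3)) => (M ^ 2 + c * (1 + ‖y‖ ^ 2) : ℝ)) x :=
        (contDiff_barrier (M ^ 2) c).contDiffAt
      have h3 : (Δ (fun y => e * ‖om t y‖ ^ 2)) x = e * (Δ (fun y => ‖om t y‖ ^ 2)) x := by
        have : (fun y => e * ‖om t y‖ ^ 2) = e • fun y => ‖om t y‖ ^ 2 := by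
          funext y; simp only [Pi.smul_apply, smul_eq_mul]
        rw [this, laplacian_smul e hn.contDiffAt, smul_eq_mul]
      have h4 := h1.laplacian_sub h2
      have hfun : w t = (fun y => e * ‖om t y‖ ^ 2) -
          fun y : (EuclideanSpace ℝ (Fin 3)) => (M ^ 2 + c * (1 + ‖y‖ ^ 2) : ℝ) := by
        funext y
        rfl
      rw [hfun, h4, h3, laplacian_barrier]
    have hvisc : ν * (e * (2 * ⟪om t x, (Δ (om t)) x⟫)) ≤ ν * (6 * c) := by
      refine mul_le_mul_of_nonneg_left ?_ hν
      have h1 := two_mul_inner_laplacian_le_laplacian_norm_sq (homC t htS) x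
      have h2 : e * (Δ (fun y => ‖om t y‖ ^ 2)) x ≤ 6 * c := by rw [hΔeq] at hlap; linarith
      calc e * (2 * ⟪om t x, (Δ (om t)) x⟫) ≤ e * (Δ (fun y => ‖om t y‖ ^ 2)) x :=
            mul_le_mul_of_nonneg_left h1 he0.le
        _ ≤ 6 * c := h2
    -- the critical-point identity: `e · 2⟪ω, Dω a⟫ = c · 2⟪x, a⟫`
    have hB := hasFDerivAt_barrier (M ^ 2) c x
    have hN : HasFDerivAt (fun y => ‖om t y‖ ^ 2)
        ((2 : ℕ) • (innerSL ℝ (om t x)).comp (fderiv ℝ (om t) x)) x := by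
      have := (homd t htS x).hasFDerivAt.norm_sq
      simpa using this
    have hwderiv : HasFDerivAt (w t)
        (e • ((2 : ℕ) • (innerSL ℝ (om t x)).comp (fderiv ℝ (om t) x)) -
          c • ((2 : ℕ) • (innerSL ℝ x : (EuclideanSpace ℝ (Fin 3)) →L[ℝ] ℝ))) x := by
      have h := (hN.const_mul e).sub hB
      simp only [hw, hc, he]
      exact h
    have hDeq : e • ((2 : ℕ) • (innerSL ℝ (om t x)).comp (fderiv ℝ (om t) x)) =
        c • ((2 : ℕ) • (innerSL ℝ x : (EuclideanSpace ℝ (Fin 3)) →L[ℝ] ℝ)) := by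
      have := hwderiv.fderiv
      rw [hgrad] at this
      exact (sub_eq_zero.1 this.symm)
    have hDapply : ∀ a : (EuclideanSpace ℝ (Fin 3)), e * (2 * ⟪om t x, fderiv ℝ (om t) x a⟫) = c * (2 * ⟪x, a⟫) := fun a => by
      have := congrArg (fun L : (EuclideanSpace ℝ (Fin 3)) →L[ℝ] ℝ => L a) hDeq
      simpa [innerSL_apply_apply, nsmul_eq_mul] using this
    -- the transport term at the critical point
    have hconv : -(c * (2 * ⟪x, u t x⟫)) ≤ c * (2 * (‖x‖ * V)) := by
      have h1 : |⟪x, u t x⟫| ≤ ‖x‖ * ‖u t x‖ := abs_real_inner_le_norm _ _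
      have h2 : ‖x‖ * ‖u t x‖ ≤ ‖x‖ * V := mul_le_mul_of_nonneg_left (hV t htI x) (norm_nonneg _)
      have h3 := (abs_le.1 (h1.trans h2)).1
      nlinarith
    -- the stretching term: `⟪ω, Du ω⟫ ≤ λ |ω|²` (the hypothesis)
    have hstretch : ⟪om t x, fderiv ℝ (u t) x (om t x)⟫ ≤ lam t * ‖om t x‖ ^ 2 := by
      rw [hom_app]
      exact hα t ht x
    -- `e · 2⟪ω, ωₜ⟫ = e · 2⟪ω, Du ω⟫ − c · 2⟪x, u⟫`
    have hkey : e * (2 * ⟪om t x, omt t x⟫) =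
        e * (2 * ⟪om t x, fderiv ℝ (u t) x (om t x)⟫) + ν * (e * (2 * ⟪om t x, (Δ (om t)) x⟫)) -
          c * (2 * ⟪x, u t x⟫) := by
      rw [hpde, inner_sub_right, inner_add_right, real_inner_smul_right, ← hDapply (u t x)]
      ring
    -- assemble
    set A : ℝ := c * (1 + ‖x‖ ^ 2) with hA
    have hA0 : 0 ≤ A := by positivity
    have hx2 : 2 * (‖x‖ * V) ≤ V * (1 + ‖x‖ ^ 2) := by
      nlinarith [sq_nonneg (‖x‖ - 1), norm_nonneg x]
    have hx2' : c * (2 * (‖x‖ * V)) ≤ V * A := by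
      calc c * (2 * (‖x‖ * V)) ≤ c * (V * (1 + ‖x‖ ^ 2)) := mul_le_mul_of_nonneg_left hx2 hc0.le
        _ = V * A := by rw [hA]; ring
    have e3 : wₜ t x = e * (-2 * lam t) * ‖om t x‖ ^ 2 + e * (2 * ⟪om t x, omt t x⟫) - β * A := by
      simp only [hwₜ, hA, hc, he]; ring
    have hst' : e * (2 * ⟪om t x, fderiv ℝ (u t) x (om t x)⟫) ≤ e * (2 * (lam t * ‖om t x‖ ^ 2)) := by
      gcongr
    have h6 : ν * (6 * c) ≤ 6 * ν * A := by
      have hpos : 0 ≤ ν * c * ‖x‖ ^ 2 := by positivity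
      have e : 6 * ν * A - ν * (6 * c) = 6 * (ν * c * ‖x‖ ^ 2) := by rw [hA]; ring
      linarith
    have e2 : β * A = 6 * ν * A + V * A + A := by rw [hβ]; ring
    rw [e3, hkey]
    nlinarith
  -- (e) the parabolic boundary: `t = t₀`
  have hbot : ∀ x ∈ K, w t₀ x ≤ 0 := by
    intro x _
    have hwt : w t₀ x = Real.exp (-2 * Λ t₀) * ‖om t₀ x‖ ^ 2 -
        (M ^ 2 + ε * Real.exp (β * (t₀ - t₀)) * (1 + ‖x‖ ^ 2)) := rfl
    rw [hwt, hΛ0, sub_self, mul_zero, mul_zero, Real.exp_zero, one_mul, mul_one]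
    have h1 : ‖om t₀ x‖ ^ 2 ≤ M ^ 2 := by
      rw [hom_app]
      exact pow_le_pow_left₀ (norm_nonneg _) (hM x) 2
    have h3 : 0 ≤ ε * (1 + ‖x‖ ^ 2) := by positivity
    linarith
  -- (f) the parabolic boundary: the sphere `|x| = R`
  have hlat : ∀ t ∈ Icc t₀ t₁, ∀ x ∈ K \ U, w t x ≤ 0 := by
    intro t ht x hx
    have hexp1 : 1 ≤ Real.exp (β * (t - t₀)) := Real.one_le_exp (mul_nonneg hβ0 (by linarith [ht.1]))
    have hH : ε * (1 + ‖x‖ ^ 2) ≤ ε * Real.exp (β * (t - t₀)) * (1 + ‖x‖ ^ 2) := by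
      have : ε * (1 + ‖x‖ ^ 2) * 1 ≤ ε * (1 + ‖x‖ ^ 2) * Real.exp (β * (t - t₀)) :=
        mul_le_mul_of_nonneg_left hexp1 (by positivity)
      linarith
    have hxK : ‖x‖ ≤ R := mem_closedBall_zero_iff.1 hx.1
    have hxR : ‖x‖ = R := by
      have hnot : x ∉ ball (0 : (EuclideanSpace ℝ (Fin 3))) R := hx.2
      have : R ≤ ‖x‖ := by simpa using hnot
      exact le_antisymm hxK this
    -- `e^{-2Λ} |ω|² ≤ W²`
    have homW : Real.exp (-2 * Λ t) * ‖om t x‖ ^ 2 ≤ W ^ 2 := by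
      have h1 : ‖om t x‖ ^ 2 ≤ W ^ 2 := by
        rw [hom_app]
        exact pow_le_pow_left₀ (norm_nonneg _) (hW t ht x) 2
      have h2 : Real.exp (-2 * Λ t) ≤ 1 := by
        rw [Real.exp_le_one_iff]
        have := hΛnn t ht
        linarith
      calc Real.exp (-2 * Λ t) * ‖om t x‖ ^ 2 ≤ 1 * ‖om t x‖ ^ 2 :=
            mul_le_mul_of_nonneg_right h2 (by positivity)
        _ ≤ W ^ 2 := by rw [one_mul]; exact h1
    -- `W² ≤ ε R ≤ ε (1 + R²)`
    have hWR : W ^ 2 ≤ ε * (1 + ‖x‖ ^ 2) := by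
      rw [hxR]
      have h1 : W ^ 2 ≤ ε * R := by rwa [div_le_iff₀' hε] at hR
      have h2 : R ≤ 1 + R ^ 2 := by nlinarith [sq_nonneg (R - 1)]
      nlinarith
    have hwt : w t x = Real.exp (-2 * Λ t) * ‖om t x‖ ^ 2 -
        (M ^ 2 + ε * Real.exp (β * (t - t₀)) * (1 + ‖x‖ ^ 2)) := rfl
    rw [hwt]
    have hM2 : 0 ≤ M ^ 2 := sq_nonneg M
    linarith
  exact weak_max_principle hKc hUo hUK hc h2 ht hsub hbot hlat

/-! ### The rate `‖ω(t)‖_∞ ≤ ‖ω(t₀)‖_∞ ((T − t₀)/(T − t))^{M₀}` under a stretching bound, `ν ≥ 0` -/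

/-- **The rate under a Type-I STRETCHING bound, `ν ≥ 0`**: let `(u, p)` be a classical solution of the unforced
system with viscosity `ν ≥ 0` on `ℝ³ × [0, T)` of the Beale–Kato–Majda class (all Sobolev norms bounded on every
`[0, T'']`, `T'' < T`), let `t₀ ∈ [0, T)`, `0 ≤ M₀`, and assume `(T − t) ⟪ω(t, x), D(u t)(x) ω(t, x)⟫ ≤ M₀ |ω(t, x)|²`
for all `t ∈ [t₀, T)` and all `x` (`(T − t)·α ≤ M₀` wherever `ω ≠ 0`). If `‖ω(t₀, x)‖ ≤ M` for all `x`, then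
`‖ω(t, x)‖ ≤ M ((T − t₀)/(T − t))^{M₀}` for all `t ∈ [t₀, T)`, `x ∈ ℝ³` (the weight `Λ(s) = M₀(log(T−t₀) − log(T−s))`;
velocity/vorticity sup bounds from the class). [cite: Chae2010, Thm 1.1 (proof, arXiv:0711.1113 p. 3)] -/
theorem norm_curl_le_mul_rpow_of_typeI_stretching_of_nonneg
    {ν T t₀ M₀ M : ℝ} {u : ℝ → (EuclideanSpace ℝ (Fin 3)) → (EuclideanSpace ℝ (Fin 3))}
    {p : ℝ → (EuclideanSpace ℝ (Fin 3)) → ℝ}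
    (hν : 0 ≤ ν) (hcl : IsClassicalNSSolutionOn (Ico 0 T) ν 0 u p)
    (hreg : ∀ T'' < T, HasBoundedSobolevNormsOn (Icc 0 T'') u)
    (ht₀ : t₀ ∈ Ico 0 T) (hM₀ : 0 ≤ M₀)
    (hbd : ∀ t ∈ Ico t₀ T, ∀ x,
      (T - t) * ⟪curl (u t) x, fderiv ℝ (u t) x (curl (u t) x)⟫ ≤ M₀ * ‖curl (u t) x‖ ^ 2)
    (hM : ∀ x, ‖curl (u t₀) x‖ ≤ M) :
    ∀ t ∈ Ico t₀ T, ∀ x, ‖curl (u t) x‖ ≤ M * ((T - t₀) / (T - t)) ^ M₀ := by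
  intro t ht x
  have hTt : 0 < T - t := sub_pos.2 ht.2
  have hTt₀ : 0 < T - t₀ := sub_pos.2 ht₀.2
  -- velocity and vorticity bounds on the slab `[t₀, t] × ℝ³` from the class on `[0, t]`
  have hB := hreg t ht.2
  have hsmooth : ∀ s ∈ Icc 0 t, ContDiff ℝ ∞ (u s) := fun s hs =>
    hcl.contDiff_velocity ⟨hs.1, hs.2.trans_lt ht.2⟩
  obtain ⟨V, -, hV⟩ := exists_forall_norm_iteratedFDeriv_le_bkmClass hsmooth hB 0
  obtain ⟨R, hRtop, hR⟩ := exists_enorm_curl_le_of_hasBoundedSobolevNormsOn hsmooth hB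
  have hV' : ∀ s ∈ Icc t₀ t, ∀ y, ‖u s y‖ ≤ V := fun s hs y => by
    have := hV s ⟨ht₀.1.trans hs.1, hs.2⟩ y
    rwa [norm_iteratedFDeriv_zero] at this
  have hW' : ∀ s ∈ Icc t₀ t, ∀ y, ‖curl (u s) y‖ ≤ R.toReal := fun s hs y =>
    calc ‖curl (u s) y‖ = (‖curl (u s) y‖ₑ).toReal := (toReal_enorm _).symm
      _ ≤ R.toReal := ENNReal.toReal_mono hRtop.ne (hR s ⟨ht₀.1.trans hs.1, hs.2⟩ y)
  -- the weight `Λ(s) = M₀ (log (T − t₀) − log (T − s))`, `Λ′(s) = M₀/(T − s)`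
  set Λ : ℝ → ℝ := fun s => M₀ * (Real.log (T - t₀) - Real.log (T - s)) with hΛ
  set lam : ℝ → ℝ := fun s => M₀ / (T - s) with hlam
  have hΛc : ContinuousOn Λ (Icc t₀ t) := by
    have h1 : ContinuousOn (fun s : ℝ => Real.log (T - s)) (Icc t₀ t) :=
      (continuousOn_const.sub continuousOn_id).log fun s hs =>
        (sub_pos.2 (lt_of_le_of_lt hs.2 ht.2)).ne'
    exact continuousOn_const.mul (continuousOn_const.sub h1)
  have hΛ0 : Λ t₀ = 0 := by simp [hΛ]
  have hΛnn : ∀ s ∈ Icc t₀ t, 0 ≤ Λ s := fun s hs => by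
    have hTs : 0 < T - s := sub_pos.2 (lt_of_le_of_lt hs.2 ht.2)
    have h1 := Real.log_le_log hTs (by linarith [hs.1] : T - s ≤ T - t₀)
    exact mul_nonneg hM₀ (by linarith)
  have hΛd : ∀ s ∈ Ioc t₀ t, HasDerivAt Λ (lam s) s := fun s hs => by
    have hTs : 0 < T - s := sub_pos.2 (lt_of_le_of_lt hs.2 ht.2)
    have h1 : HasDerivAt (fun r : ℝ => T - r) (-1) s := by
      simpa using (hasDerivAt_id s).const_sub T
    have h3 := ((h1.log hTs.ne').const_sub (Real.log (T - t₀))).const_mul M₀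
    refine h3.congr_deriv ?_
    rw [hlam]
    field_simp
  have hα : ∀ s ∈ Ioc t₀ t, ∀ y,
      ⟪curl (u s) y, fderiv ℝ (u s) y (curl (u s) y)⟫ ≤ lam s * ‖curl (u s) y‖ ^ 2 := fun s hs y => by
    have hTs : 0 < T - s := sub_pos.2 (lt_of_le_of_lt hs.2 ht.2)
    have h1 := hbd s ⟨hs.1.le, lt_of_le_of_lt hs.2 ht.2⟩ y
    show ⟪curl (u s) y, fderiv ℝ (u s) y (curl (u s) y)⟫ ≤ M₀ / (T - s) * ‖curl (u s) y‖ ^ 2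
    rw [div_mul_eq_mul_div, le_div_iff₀ hTs, mul_comm]
    exact h1
  have key := exp_neg_mul_norm_curl_le_of_stretching_le_of_nonneg hν hcl ht₀.1 ht.1 ht.2 hV' hW' hM
    hΛc hΛ0 hΛnn hΛd hα t ⟨ht.1, le_rfl⟩ x
  -- `e^{−Λ(t)} = ((T − t)/(T − t₀))^{M₀}`
  have hexp : Real.exp (-Λ t) = ((T - t) / (T - t₀)) ^ M₀ := by
    rw [Real.rpow_def_of_pos (div_pos hTt hTt₀), Real.log_div hTt.ne' hTt₀.ne']
    congr 1
    simp only [hΛ]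
    ring
  rw [hexp] at key
  have hq : 0 < ((T - t) / (T - t₀)) ^ M₀ := Real.rpow_pos_of_pos (div_pos hTt hTt₀) _
  have hinv : ((T - t₀) / (T - t)) ^ M₀ = (((T - t) / (T - t₀)) ^ M₀)⁻¹ := by
    rw [← Real.inv_rpow (div_pos hTt hTt₀).le, inv_div]
  rw [hinv, ← div_eq_mul_inv, le_div_iff₀ hq, mul_comm]
  exact key

/-! ### The threshold theorem, `ν ≥ 0` -/

/-- **The Type-I STRETCHING threshold for Navier–Stokes and Euler (`ν ≥ 0`)**: let `ν ≥ 0`, `T > 0`, and let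
`(u, p)` be a classical unforced solution with viscosity `ν` on `ℝ³ × [0, T)` of the Beale–Kato–Majda class. If for
some `M₀ < 1` and `t₀ ∈ [0, T)` one has `(T − t)⟪ω(t, x), D(u(t))(x) ω(t, x)⟫ ≤ M₀ |ω(t, x)|²` for all `t ∈ [t₀, T)` and
all `x` — the vortex-stretching rate `α = ⟪ξ, ∇u ξ⟫` obeys `(T − t)α ≤ M₀` wherever `ω ≠ 0` — then the solution continues
in the class past `T` (`HasSobolevExtensionPast ν u T`). Proof: replace `M₀` by `max M₀ 0`; the vorticity is bounded on
`[0, t₀]` in the class, `‖ω(t, x)‖ ≤ ‖ω(t₀)‖_∞((T − t₀)/(T − t))^{M₀}` on `[t₀, T)`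
(`norm_curl_le_mul_rpow_of_typeI_stretching_of_nonneg`), `M₀ < 1` ⇒ `∫₀ᵀ ‖ω(t)‖_∞ dt < ∞`, and Beale–Kato–Majda for
`ν ≥ 0` (`beale_kato_majda_holds`). The gradient form (`typeI_gradient_threshold_of_nonneg`) is the special case
`⟪ω, ∇u ω⟫ ≤ ‖∇u‖ |ω|²`. [cite: Chae2010, Thm 1.1 (= arXiv:0711.1113 Thm 1.1, proof p. 3–4); BealeKatoMajda1984, Thm 1; MajdaBertozziCUP2002, Thm 3.6 and p. 117] -/
theorem typeI_stretching_threshold_of_nonneg {ν : ℝ} (hν : 0 ≤ ν) {T : ℝ} (hT : 0 < T)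
    {u : ℝ → (EuclideanSpace ℝ (Fin 3)) → (EuclideanSpace ℝ (Fin 3))}
    {p : ℝ → (EuclideanSpace ℝ (Fin 3)) → ℝ} (hsol : IsClassicalNSSolutionOn (Ico 0 T) ν 0 u p)
    (hreg : ∀ T'' < T, HasBoundedSobolevNormsOn (Icc 0 T'') u)
    {M₀ : ℝ} (hM₀1 : M₀ < 1) {t₀ : ℝ} (ht₀ : t₀ ∈ Ico 0 T)
    (hbd : ∀ t ∈ Ico t₀ T, ∀ x,
      (T - t) * ⟪curl (u t) x, fderiv ℝ (u t) x (curl (u t) x)⟫ ≤ M₀ * ‖curl (u t) x‖ ^ 2) :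
    HasSobolevExtensionPast ν u T := by
  -- replace `M₀` by `M₁ = max M₀ 0 ∈ [0, 1)`
  set M₁ : ℝ := max M₀ 0 with hM₁
  have hM₀0 : 0 ≤ M₁ := le_max_right _ _
  have hM₁1 : M₁ < 1 := max_lt hM₀1 one_pos
  have hbd' : ∀ t ∈ Ico t₀ T, ∀ x,
      (T - t) * ⟪curl (u t) x, fderiv ℝ (u t) x (curl (u t) x)⟫ ≤ M₁ * ‖curl (u t) x‖ ^ 2 :=
    fun t ht x => (hbd t ht x).trans (mul_le_mul_of_nonneg_right (le_max_left _ _) (sq_nonneg _))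
  -- the vorticity is bounded on `[0, t₀]` in the class
  have hsm0 : ∀ s ∈ Icc 0 t₀, ContDiff ℝ ∞ (u s) := fun s hs =>
    hsol.contDiff_velocity ⟨hs.1, hs.2.trans_lt ht₀.2⟩
  obtain ⟨R₀, hR₀top, hR₀⟩ :=
    exists_enorm_curl_le_of_hasBoundedSobolevNormsOn hsm0 (hreg t₀ ht₀.2)
  set M : ℝ := R₀.toReal with hMdef
  have hMt₀ : ∀ x, ‖curl (u t₀) x‖ ≤ M := fun x =>
    calc ‖curl (u t₀) x‖ = (‖curl (u t₀) x‖ₑ).toReal := (toReal_enorm _).symm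
      _ ≤ M := ENNReal.toReal_mono hR₀top.ne (hR₀ t₀ ⟨ht₀.1, le_rfl⟩ x)
  -- the growth bound on `[t₀, T)`
  have hgrowth := norm_curl_le_mul_rpow_of_typeI_stretching_of_nonneg hν hsol hreg ht₀ hM₀0 hbd' hMt₀
  -- a majorant of `t ↦ ‖ω(t)‖_∞` on `(0, T)`
  set C : ℝ := M * (T - t₀) ^ M₁ with hC
  have hmaj : ∀ t ∈ Ioo 0 T,
      (⨆ x, ‖curl (u t) x‖ₑ) ≤ R₀ + ENNReal.ofReal (C * (T - t) ^ (-M₁)) := by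
    intro t ht
    refine iSup_le fun x => ?_
    rcases le_or_gt t t₀ with hle | hlt
    · exact (hR₀ t ⟨ht.1.le, hle⟩ x).trans le_self_add
    · have h1 := hgrowth t ⟨hlt.le, ht.2⟩ x
      have h2 : M * ((T - t₀) / (T - t)) ^ M₁ = C * (T - t) ^ (-M₁) := by
        rw [hC, Real.div_rpow (sub_pos.2 ht₀.2).le (sub_pos.2 ht.2).le,
          Real.rpow_neg (sub_pos.2 ht.2).le]
        ring
      calc ‖curl (u t) x‖ₑ = ENNReal.ofReal ‖curl (u t) x‖ := (ofReal_norm _).symm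
        _ ≤ ENNReal.ofReal (C * (T - t) ^ (-M₁)) := ENNReal.ofReal_le_ofReal (h1.trans_eq h2)
        _ ≤ R₀ + ENNReal.ofReal (C * (T - t) ^ (-M₁)) := le_add_self
  -- `t ↦ (T − t)^{−M₁}` is integrable on `(0, T)` since `M₁ < 1`
  have hint : IntegrableOn (fun t : ℝ => C * (T - t) ^ (-M₁)) (Ioo 0 T) volume := by
    have h1 : IntervalIntegrable (fun x : ℝ => x ^ (-M₁)) volume T 0 :=
      intervalIntegral.intervalIntegrable_rpow' (by linarith)
    have h2 := h1.comp_sub_left T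
    rw [sub_self, sub_zero] at h2
    exact ((intervalIntegrable_iff_integrableOn_Ioo_of_le hT.le).1 h2).const_mul C
  -- `∫₀ᵀ ‖ω(t)‖_∞ dt < ∞`
  have hfin : (∫⁻ t in Ioo 0 T, ⨆ x, ‖curl (u t) x‖ₑ) < ⊤ := by
    calc (∫⁻ t in Ioo 0 T, ⨆ x, ‖curl (u t) x‖ₑ)
        ≤ ∫⁻ t in Ioo 0 T, (R₀ + ENNReal.ofReal (C * (T - t) ^ (-M₁))) :=
          setLIntegral_mono' measurableSet_Ioo hmaj
      _ = (∫⁻ _ in Ioo 0 T, R₀) + ∫⁻ t in Ioo 0 T, ENNReal.ofReal (C * (T - t) ^ (-M₁)) :=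
          lintegral_add_left measurable_const _
      _ < ⊤ := by
          refine ENNReal.add_lt_top.2 ⟨?_, ?_⟩
          · rw [setLIntegral_const, Real.volume_Ioo]
            exact ENNReal.mul_lt_top hR₀top ENNReal.ofReal_lt_top
          · exact lt_of_le_of_lt (lintegral_mono fun t => Real.ofReal_le_enorm _) hint.2
  -- Beale–Kato–Majda (`ν ≥ 0`)
  exact (beale_kato_majda_holds hν hT hsol hreg).2 hfin

/-! ### Blow-up form -/

/-- **`limsup_{t→T} (T−t)·sup_x α⁺(t, x) ≥ 1` at a blow-up time, `ν ≥ 0`**: if `T` IS a blow-up time of the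
Beale–Kato–Majda class for a classical unforced solution with viscosity `ν ≥ 0` on `ℝ³ × [0, T)` (no continuation in
the class past `T`), then for every `M₀ < 1` and every `t₀ ∈ [0, T)` there are `t ∈ [t₀, T)` and `x` with
`M₀|ω(t, x)|² < (T − t)⟪ω(t, x), D(u(t))(x) ω(t, x)⟫` — so `ω(t, x) ≠ 0` and the stretching rate there exceeds
`M₀/(T − t)`. Sharpens `exists_typeI_gradient_gt_of_not_hasSobolevExtensionPast` (`α ≤ ‖∇u‖`).
[cite: Chae2010, Thm 1.1 (ν = 0); Constantin1994, §2; BealeKatoMajda1984, Thm 1] -/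
theorem exists_typeI_stretching_gt_of_not_hasSobolevExtensionPast {ν : ℝ} (hν : 0 ≤ ν) {T : ℝ}
    (hT : 0 < T) {u : ℝ → (EuclideanSpace ℝ (Fin 3)) → (EuclideanSpace ℝ (Fin 3))}
    {p : ℝ → (EuclideanSpace ℝ (Fin 3)) → ℝ} (hsol : IsClassicalNSSolutionOn (Ico 0 T) ν 0 u p)
    (hreg : ∀ T'' < T, HasBoundedSobolevNormsOn (Icc 0 T'') u)
    (hblowup : ¬ HasSobolevExtensionPast ν u T) {M₀ : ℝ} (hM₀ : M₀ < 1) {t₀ : ℝ}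
    (ht₀ : t₀ ∈ Ico 0 T) :
    ∃ t ∈ Ico t₀ T, ∃ x : EuclideanSpace ℝ (Fin 3),
      M₀ * ‖curl (u t) x‖ ^ 2 < (T - t) * ⟪curl (u t) x, fderiv ℝ (u t) x (curl (u t) x)⟫ := by
  by_contra hcon
  push Not at hcon
  exact hblowup (typeI_stretching_threshold_of_nonneg hν hT hsol hreg hM₀ ht₀ hcon)

end Literature.Analysis.FluidPDE

end
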